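import Summits.PneNP.PneNP.Theses.ReslinSizeFromWidth
import Summits.PneNP.PneNP.Theorems.ReslinSizeFromWidthWidthFromVertexExpansionBridge
import Summits.PneNP.PneNP.Theorems.ReslinSizeFromWidthWidthFromVertexExpansionLAL
import Literature.Computability.MetaComplexity.RevResLin

/-!
# PneNP / ReslinSizeFromWidth — `WidthFromVertexExpansion` (stmt-PneNP-18934): cover expansion
forces Res(⊕) rank

Route `PneNP/ReslinSizeFromWidth`, support item stmt-PneNP-18934. THE RUNG: for `γ > 0`, `r ≥ 2`
and every CNF `φ` whose clause scopes form an `(r, 1+γ)`-COVER expander (every `≤ r` clause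
positions cover `≥ (1+γ)·#positions` variables), every dag-like Res(⊕) refutation `π` of `φ`
(Itsykson–Sokolov's system with SEMANTIC weakening, `IsResLinRefutation`) contains a line `C`
of rank `rk(¬C) = linClauseRank C > γr/2`, i.e. `γr/2 < resLinWidth π`.

This is Jukna 2012, Thm 18.19 (= Ben-Sasson–Wigderson 2001, width `≥ cr/2` for `(r,c)`-expanding
CNFs in RESOLUTION) one proof system up. The proof is the same measure argument with the affine
lemmas of the two helper files in place of Hall/Tarsi:

* `μ(C)` = least number of clauses of `φ` semantically implying the line `C`; a line is CHEAP if
  `μ(C) ≤ r/2`. Axioms are cheap (`μ ≤ 1 ≤ r/2`), a weakening of a cheap line is cheap, and a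
  resolvent of two cheap lines has `μ ≤ r`.
* The empty clause is not cheap: a minimum implying set `F` with `|F| ≤ r` would give, by the
  affine Claim 18.22 (`ResLinRank.card_cover_succ_le`) at rank `0` and cover expansion,
  `(1+γ)|F| + 1 ≤ |F|`.
* Hence the FIRST non-cheap line of `π` is a resolvent with `r/2 < μ ≤ r`; for a minimum implying
  set `F` of it, `card_cover_succ_le` and expansion give
  `rank ≥ |cover F| + 1 - |F| ≥ γ|F| + 1 > γr/2`.

Deciding declaration: `widthFromVertexExpansion_proof :
Summit.PneNP.PneNP.Theses.ReslinSizeFromWidth.WidthFromVertexExpansion`.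

References: S. Jukna, *Boolean Function Complexity* (2012), §18.8, Thm 18.19 with Claims
18.20–18.22 [Jukna2012]; E. Ben-Sasson, A. Wigderson, J. ACM 48 (2001), §5 [BenSassonWigderson2001];
D. Itsykson, D. Sokolov, APAL 171 (2020), §2 [ItsyksonSokolov2020]; K. Efremenko, M. Garlík,
D. Itsykson, STOC 2024, Thm 5.5 (the only earlier DIRECT rank bound, for BPHP)
[EfremenkoGarlikItsykson2024]; R. Rado 1942 [Rado1942].
-/

namespace Summit.PneNP.PneNP.Theorems

-- `Summit.PneNP.PneNP` repeats a path component by design (summit = sub-problem); silence the linter.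
set_option linter.dupNamespace false

open Finset Literature.Computability.Complexity Literature.Computability.MetaComplexity

namespace ResLinRank

open Module Literature.Computability.MetaComplexity.AffSys

/-! ### The affine Claim 18.22: minimal implication forces rank -/

/-- **From a minimally implying clause set to rank.** If the clauses of `φ` at the positions
`F ≠ ∅` semantically imply the linear clause `C` and no proper subset of `F` does, then
`|cover (cnfScopes φ) F| + 1 ≤ |F| + rk(¬C)`. (Affine version of Jukna 2012, Claim 18.22, via the
linear Aharoni–Linial lemma; tautological clauses are excluded by minimality.) -/
theorem card_cover_succ_le (φ : CNF ℕ) (C : LinClause) (F : Finset (Fin φ.length))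
    (hne : F.Nonempty)
    (himp : ∀ σ : ℕ → Bool, (∀ i ∈ F, Clause.eval σ φ[i] = true) → C.eval σ = true)
    (hmin : ∀ F' ⊂ F, ∃ σ : ℕ → Bool, (∀ i ∈ F', Clause.eval σ φ[i] = true) ∧ C.eval σ = false) :
    (cover (cnfScopes φ) F).card + 1 ≤ F.card + linClauseRank C := by
  classical
  set N : Finset ℕ := cover (cnfScopes φ) F ∪ C.biUnion (fun l => l.1) with hN
  have hcovN : cover (cnfScopes φ) F ⊆ N := Finset.subset_union_left
  have hformN : ∀ l ∈ C, l.1 ⊆ N := fun l hl =>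
    (Finset.subset_biUnion_of_mem (fun l : LinLit => l.1) hl).trans Finset.subset_union_right
  have hscopeN : ∀ i ∈ F, clauseScope φ[i] ⊆ N := fun i hi =>
    (subset_cover (S := cnfScopes φ) hi).trans hcovN
  -- the clauses of a minimal `F` are not tautologies
  have hnt : ∀ i ∈ F, ¬ ∃ x, ((x, true) : Literal ℕ) ∈ φ[i] ∧ ((x, false) : Literal ℕ) ∈ φ[i] := by
    rintro i hi ⟨x, hxt, hxf⟩
    obtain ⟨σ, hσ, hC⟩ := hmin (F.erase i) (Finset.erase_ssubset hi)
    have hall : ∀ j ∈ F, Clause.eval σ φ[j] = true := by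
      intro j hj
      by_cases hji : j = i
      · rw [hji, Clause.eval, List.any_eq_true]
        cases hx : σ x
        · exact ⟨(x, false), hxf, by simp [Literal.eval, hx]⟩
        · exact ⟨(x, true), hxt, by simp [Literal.eval, hx]⟩
      · exact hσ j (Finset.mem_erase.2 ⟨hji, hj⟩)
    have := himp σ hall
    rw [hC] at this
    exact Bool.false_ne_true this
  -- `¬C` is consistent
  have hcons : (Sol (negSys N C)).Nonempty := by
    obtain ⟨σ, -, hC⟩ := hmin ∅ (Finset.empty_ssubset.2 hne)
    exact ⟨zOf N σ, (zOf_mem_Sol_negSys_iff hformN σ).2 hC⟩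
  -- `F` is minimally unsatisfiable together with `¬C`
  have hmu : MinimalPsiUnsat (scopeN N φ) (pattern N φ) (negSys N C) F := by
    constructor
    · rintro ⟨z, hz, hsat⟩
      have hzz : zOf N (σOf N z) = z := zOf_σOf N z
      rw [← hzz] at hz hsat
      have hC := (zOf_mem_Sol_negSys_iff hformN _).1 hz
      have hall : ∀ i ∈ F, Clause.eval (σOf N z) φ[i] = true := fun i hi => by
        obtain ⟨v, hv, hvne⟩ := hsat i hi
        exact clause_eval_of_ne_pattern hv hvne
      have := himp _ hall
      rw [hC] at this
      exact Bool.false_ne_true this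
    · intro J hJ
      obtain ⟨σ, hσ, hC⟩ := hmin J hJ
      refine ⟨zOf N σ, (zOf_mem_Sol_negSys_iff hformN σ).2 hC, fun i hi => ?_⟩
      exact exists_ne_pattern_of_clause_eval (hscopeN i (hJ.subset hi)) (hnt i (hJ.subset hi))
        (hσ i hi)
  -- the linear Aharoni–Linial lemma, rank form
  have hlal := card_VI_succ_le_card_add_finrank (scopeN N φ) (pattern N φ) (negSys N C) hcons F hmu
  have hVI : (VI (scopeN N φ) F).card = (cover (cnfScopes φ) F).card := by
    rw [VI, biUnion_scopeN_eq, Finset.card_subtype,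
      Finset.filter_true_of_mem (fun x hx => hcovN hx)]
  have hrk := finrank_spanS_negSys_le N C
  omega

end ResLinRank

/-- Two cheap premises give a resolvent implied by the union of their implying sets: if `F₁`
implies `A ∨ (f = 0)` and `F₂` implies `B ∨ (f = 1)` then `F₁ ∪ F₂` implies `A ∨ B`. -/
theorem ResLinRank.implies_resolvent {φ : CNF ℕ} {F₁ F₂ : Finset (Fin φ.length)}
    {A B : LinClause} {f : Finset ℕ}
    (h₁ : ∀ σ : ℕ → Bool, (∀ i ∈ F₁, Clause.eval σ φ[i] = true) →
      LinClause.eval σ (insert (f, false) A) = true)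
    (h₂ : ∀ σ : ℕ → Bool, (∀ i ∈ F₂, Clause.eval σ φ[i] = true) →
      LinClause.eval σ (insert (f, true) B) = true)
    (σ : ℕ → Bool) (hσ : ∀ i ∈ F₁ ∪ F₂, Clause.eval σ φ[i] = true) :
    LinClause.eval σ (A ∪ B) = true := by
  have hA := h₁ σ (fun i hi => hσ i (Finset.mem_union_left _ hi))
  have hB := h₂ σ (fun i hi => hσ i (Finset.mem_union_right _ hi))
  rw [LinClause.eval_insert] at hA hB
  rw [LinClause.eval_union]
  cases h0 : LinLit.eval σ (f, false) <;> cases h1 : LinLit.eval σ (f, true) <;>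
    simp_all [LinLit.not_eval_false_and_true σ f]
  exact absurd (LinLit.not_eval_false_and_true σ f h0 h1) id

/-- **`WidthFromVertexExpansion`** (item stmt-PneNP-18934 of route ReslinSizeFromWidth; the
Res(⊕) rank rung): for `γ > 0`, `r ≥ 2` and a CNF `φ` whose clause scopes form an
`(r, 1+γ)`-cover expander, every Res(⊕) refutation `π` of `φ` has `γ·r/2 < resLinWidth π`.
Jukna 2012 Thm 18.19 one system up: the `μ`-walk finds a resolvent whose minimum implying set `F`
has `r/2 < |F| ≤ r`, and the affine Claim 18.22 (`ResLinRank.card_cover_succ_le`, via Rado's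
theorem and the linear Aharoni–Linial lemma) with cover expansion gives rank `> γ|F| ≥ γr/2`.
[Jukna2012, Thm 18.19; BenSassonWigderson2001, §5; EfremenkoGarlikItsykson2024, Thm 5.5] -/
theorem widthFromVertexExpansion_proof :
    Summit.PneNP.PneNP.Theses.ReslinSizeFromWidth.WidthFromVertexExpansion := by
  unfold Summit.PneNP.PneNP.Theses.ReslinSizeFromWidth.WidthFromVertexExpansion
  intro γ r φ hγ hr hexp π hπ
  classical
  -- (1) minimum implying sets: existence, and the rank consequence of the affine Claim 18.22
  have key : ∀ (D : LinClause) (F : Finset (Fin φ.length)),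
      (∀ σ : ℕ → Bool, (∀ i ∈ F, Clause.eval σ φ[i] = true) → D.eval σ = true) →
      (F.card : ℝ) ≤ r →
      ∃ F' : Finset (Fin φ.length), F'.card ≤ F.card ∧
        (∀ σ : ℕ → Bool, (∀ i ∈ F', Clause.eval σ φ[i] = true) → D.eval σ = true) ∧
        (F'.Nonempty → (1 + γ) * F'.card + 1 ≤ (F'.card : ℝ) + linClauseRank D) := by
    intro D F hF hFr
    -- a minimum-cardinality implying set
    have hex : ∃ n : ℕ, ∃ G : Finset (Fin φ.length),
        (∀ σ : ℕ → Bool, (∀ i ∈ G, Clause.eval σ φ[i] = true) → D.eval σ = true) ∧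
          G.card = n := ⟨F.card, F, hF, rfl⟩
    obtain ⟨F', hF'imp, hF'c⟩ := Nat.find_spec hex
    have hF'min : ∀ G : Finset (Fin φ.length),
        (∀ σ : ℕ → Bool, (∀ i ∈ G, Clause.eval σ φ[i] = true) → D.eval σ = true) →
          F'.card ≤ G.card := by
      intro G hG
      rw [hF'c]
      exact Nat.find_min' hex ⟨G, hG, rfl⟩
    refine ⟨F', hF'min F hF, hF'imp, fun hne' => ?_⟩
    have hmin : ∀ F'' ⊂ F', ∃ σ : ℕ → Bool,
        (∀ i ∈ F'', Clause.eval σ φ[i] = true) ∧ D.eval σ = false := by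
      intro F'' hss
      by_contra h
      push Not at h
      have hP : ∀ σ : ℕ → Bool, (∀ i ∈ F'', Clause.eval σ φ[i] = true) → D.eval σ = true :=
        fun σ hσ => by simpa using h σ hσ
      exact absurd (Finset.card_lt_card hss) (not_lt.2 (hF'min F'' hP))
    have hbridge := ResLinRank.card_cover_succ_le φ D F' hne' hF'imp hmin
    have hexpF : (1 + γ) * (F'.card : ℝ) ≤ ((cover (cnfScopes φ) F').card : ℝ) :=
      hexp F' (le_trans (by exact_mod_cast hF'min F hF) hFr)
    have hb : ((cover (cnfScopes φ) F').card : ℝ) + 1 ≤ (F'.card : ℝ) + (linClauseRank D : ℝ) := by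
      exact_mod_cast hbridge
    linarith
  -- (2) the empty clause is not cheap
  have hempty : ¬ ∃ F : Finset (Fin φ.length),
      (∀ σ : ℕ → Bool, (∀ i ∈ F, Clause.eval σ φ[i] = true) →
        LinClause.eval σ (∅ : LinClause) = true) ∧ 2 * (F.card : ℝ) ≤ r := by
    rintro ⟨F, hF, hFr⟩
    have hFr' : (F.card : ℝ) ≤ r := by
      have : (0 : ℝ) ≤ F.card := Nat.cast_nonneg _
      linarith
    obtain ⟨F', -, hF'imp, hb⟩ := key ∅ F hF hFr'
    have hne' : F'.Nonempty := by
      rw [Finset.nonempty_iff_ne_empty]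
      rintro rfl
      have := hF'imp (fun _ => false) (by simp)
      rw [LinClause.eval_empty] at this
      exact Bool.false_ne_true this
    have h := hb hne'
    rw [linClauseRank_empty, Nat.cast_zero, add_zero] at h
    have hc : (0 : ℝ) ≤ F'.card := Nat.cast_nonneg _
    nlinarith
  -- (3) the first non-cheap line of `π`
  obtain ⟨l₀, hl₀, hl₀e⟩ := hπ.2
  obtain ⟨k₀, hk₀, hk₀l⟩ := List.getElem_of_mem hl₀
  have hex : ∃ k, ∃ hk : k < π.length, ¬ ∃ F : Finset (Fin φ.length),
      (∀ σ : ℕ → Bool, (∀ i ∈ F, Clause.eval σ φ[i] = true) →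
        (π[k]'hk).clause.eval σ = true) ∧ 2 * (F.card : ℝ) ≤ r := by
    refine ⟨k₀, hk₀, ?_⟩
    rw [hk₀l, hl₀e]
    exact hempty
  let k := Nat.find hex
  obtain ⟨hk, hkbad⟩ : ∃ hk : k < π.length, ¬ ∃ F : Finset (Fin φ.length),
      (∀ σ : ℕ → Bool, (∀ i ∈ F, Clause.eval σ φ[i] = true) →
        (π[k]'hk).clause.eval σ = true) ∧ 2 * (F.card : ℝ) ≤ r := Nat.find_spec hex
  have hcheap : ∀ j (hj : j < π.length), j < k → ∃ F : Finset (Fin φ.length),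
      (∀ σ : ℕ → Bool, (∀ i ∈ F, Clause.eval σ φ[i] = true) →
        (π[j]'hj).clause.eval σ = true) ∧ 2 * (F.card : ℝ) ≤ r := by
    intro j hj hjk
    by_contra h
    exact Nat.find_min hex hjk ⟨hj, h⟩
  -- (4) case analysis on the rule of the first non-cheap line
  have hv := hπ.1 k hk
  have hlen : (π.take k).length = k := by simp [List.length_take, hk.le]
  rcases hrule : (π[k]'hk).rule with _ | ⟨i, j, f⟩ | i
  · -- an axiom: implied by a single clause position, hence cheap
    simp only [IsValidResLinLine, hrule] at hv
    obtain ⟨c, hc, hcl⟩ := hv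
    obtain ⟨n, hn, hnc⟩ := List.getElem_of_mem hc
    refine absurd ⟨{(⟨n, hn⟩ : Fin φ.length)}, fun σ hσ => ?_, ?_⟩ hkbad
    · rw [hcl, eval_toLinClause]
      have := hσ ⟨n, hn⟩ (Finset.mem_singleton_self _)
      rw [Clause.eval] at this
      simpa [Fin.getElem_fin, hnc] using this
    · rw [Finset.card_singleton, Nat.cast_one, mul_one]
      exact hr
  · -- a resolvent of two cheap lines: `r/2 < μ ≤ r`, and the rank bound follows
    simp only [IsValidResLinLine, hrule] at hv
    obtain ⟨hi, hj, A, B, hA, hB, hcl⟩ := hv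
    have hik : i < k := by omega
    have hjk : j < k := by omega
    simp only [List.getElem_take] at hA hB
    obtain ⟨F₁, hF₁, hF₁r⟩ := hcheap i (hik.trans hk) hik
    obtain ⟨F₂, hF₂, hF₂r⟩ := hcheap j (hjk.trans hk) hjk
    rw [hA] at hF₁
    rw [hB] at hF₂
    have hF : ∀ σ : ℕ → Bool, (∀ i ∈ F₁ ∪ F₂, Clause.eval σ φ[i] = true) →
        (π[k]'hk).clause.eval σ = true := by
      intro σ hσ
      rw [hcl]
      exact ResLinRank.implies_resolvent hF₁ hF₂ σ hσ
    have hFr : ((F₁ ∪ F₂).card : ℝ) ≤ r := by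
      have h := Finset.card_union_le F₁ F₂
      have h' : ((F₁ ∪ F₂).card : ℝ) ≤ (F₁.card : ℝ) + F₂.card := by exact_mod_cast h
      linarith
    obtain ⟨F', hF'le, hF'imp, hb⟩ := key _ (F₁ ∪ F₂) hF hFr
    -- `F'` is not small, since line `k` is not cheap
    have hbig : (r : ℝ) < 2 * F'.card := by
      by_contra hle
      push Not at hle
      exact hkbad ⟨F', hF'imp, hle⟩
    have hne' : F'.Nonempty := by
      rw [← Finset.card_pos]
      have : (0 : ℝ) < F'.card := by linarith
      exact_mod_cast this
    have h := hb hne'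
    have hmem : π[k]'hk ∈ π := List.getElem_mem hk
    have hw : (linClauseRank (π[k]'hk).clause : ℝ) ≤ resLinWidth π := by
      exact_mod_cast linClauseRank_le_resLinWidth hmem
    nlinarith
  · -- a weakening of a cheap line is cheap
    simp only [IsValidResLinLine, hrule] at hv
    obtain ⟨hi, himp⟩ := hv
    have hik : i < k := by omega
    simp only [List.getElem_take] at himp
    obtain ⟨F₁, hF₁, hF₁r⟩ := hcheap i (hik.trans hk) hik
    exact absurd ⟨F₁, fun σ hσ => himp σ (hF₁ σ hσ), hF₁r⟩ hkbad

end Summit.PneNP.PneNP.Theorems
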